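import Summits.Schanuel.Schanuel.Theorems.RootDecomp1KNW96Core14

/-!
# RootDecomp1KNW96Core — continuation (RootDecomp1KNW96Core15): the EXEMPLAR CONSUMER re-typed generic in the NW96 constant (lens-6 g23, PROGRAMME G23-b (b4′) = the «G23-c TEMPLATE»; probe theorems P6/P6′ of HOME/decomp-schanuel-lens-6/g23/g23b/NW96MainProbe.lean EDITION 2 633a8388…, l.2108 / l.2194; critic L2177: ACCEPTED, BOOKKEEPING ×0 under RULE G24 (i), «may ride with NW96Core05 or a separate part `--supports stmt-Schanuel-33364`; identity diff at LANDED»; listed as owed by the critic L2217 (D) / L2234 and the writer L2205/L2226)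

(`expPair_lower_bound_of_mainR (hc : 0 ≤ c) (hNW : NW1996MainR c)` = the tree ROOT consumer `RootDecomp1KGeneric01.expPair_lower_bound_of_NW1996Thm1` (pair measure `|e^u − α| + |u − β| ≥ exp(−c_NW(|u|)·(1+L)^6)`, `c_NW(T) = 908(12+T)(4+3T)`) with the constant made GENERIC: fed `NW1996MainR c` it gives `(43/10)·c·(12+T)(4+3T)`, proof = the tree's verbatim but `211 ↦ c`; `expPair_lower_bound_400` = the same at `c = 400` HYPOTHESIS-FREE via `nw1996MainR_400` (derived constant 908 ↦ 1720). Port by census-1 gen 19; statements and proofs verbatim from P ed. 2; imports tree Core14 (so `nw1996MainR_211` / `nesterenkoWaldschmidt1996_thm_1_holds` are in the cone too — since node 2 the tree's own Generic01 statement at 211 is hypothesis-free BY NAME, RULE G27 (i): constants ×0). `--supports stmt-Schanuel-33364`; no census credit; rung 0 — nothing here proves Schanuel.)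
-/

noncomputable section

open Finset

namespace Summit.Schanuel.Schanuel.Theorems.RootDecomp1KNW96Core

open Literature.NumberTheory.Transcendental

section ConsumerTemplate

open Summit.Schanuel.Schanuel.Theorems.RootDecomp1KNW96Gap

/-- **P6. EXEMPLAR CONSUMER RE-TYPED (critic (b4′)).** The tree's
`RootDecomp1KGeneric01.expPair_lower_bound_of_NW1996Thm1` — the PAIR measure
`|e^u − α| + |u − β| ≥ exp(−c_NW(|u|)·(1+L)^6)` for every `u ≠ 0`, `[ℚ(α,β):ℚ], h(α), h(β) ≤ L`, with
`c_NW(T) = 908(12+T)(4+3T) ≥ 211·(43/10)(12+T)(4+3T)` — made GENERIC in the NW96 constant: fed `NW1996MainR c` it gives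
the constant `(43/10)·c·(12+T)(4+3T)`; the proof is the tree's, verbatim but for `211 ↦ c`. -/
theorem expPair_lower_bound_of_mainR {c : ℝ} (hc : 0 ≤ c) (hNW : NW1996MainR c) {u : ℂ} (hu0 : u ≠ 0)
    {α β : ℂ} (hα0 : α ≠ 0) (hβ0 : β ≠ 0) (hα : IsAlgebraic ℚ α) (hβ : IsAlgebraic ℚ β) {L : ℝ}
    (hL1 : 1 ≤ L) (hD : (Module.finrank ℚ ↥(IntermediateField.adjoin ℚ ({α, β} : Set ℂ)) : ℝ) ≤ L)
    (hhα : weilHeight₁ (IntermediateField.adjoin ℚ ({α, β} : Set ℂ)) (fun _ : Unit => α) ≤ L)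
    (hhβ : weilHeight₁ (IntermediateField.adjoin ℚ ({α, β} : Set ℂ)) (fun _ : Unit => β) ≤ L) :
    Real.exp (-(43 / 10 * c * (12 + ‖u‖) * (4 + 3 * ‖u‖) * (1 + L) ^ 6)) ≤
      ‖Complex.exp u - α‖ + ‖u - β‖ := by
  set D : ℕ := Module.finrank ℚ (IntermediateField.adjoin ℚ ({α, β} : Set ℂ)) with hDdef
  have hD0 : (0 : ℝ) ≤ D := Nat.cast_nonneg D
  have hDΛ : (D : ℝ) ≤ 1 + L := by linarith
  have hΛ2 : (2 : ℝ) ≤ 1 + L := by linarith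
  have hΛ0 : (0 : ℝ) ≤ 1 + L := by linarith
  -- Theorem 1 (constant `c`) at `θ = u`, `A = B = e · e^L`, `E = e`
  have hlogA : Real.log (Real.exp 1 * Real.exp L) = 1 + L := by
    rw [Real.log_mul (Real.exp_pos 1).ne' (Real.exp_pos L).ne', Real.log_exp, Real.log_exp]
  have hinvD : (1 : ℝ) / D ≤ 1 := by
    rcases Nat.eq_zero_or_pos D with h | h
    · rw [h]; norm_num
    · exact (div_le_one (by exact_mod_cast h)).mpr (by exact_mod_cast h)
  have hA : max (weilHeight₁ (IntermediateField.adjoin ℚ ({α, β} : Set ℂ)) (fun _ : Unit => α))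
      (1 / (D : ℝ)) ≤ Real.log (Real.exp 1 * Real.exp L) := by
    rw [hlogA]
    exact max_le (by linarith) (by linarith)
  have hB : weilHeight₁ (IntermediateField.adjoin ℚ ({α, β} : Set ℂ)) (fun _ : Unit => β) ≤
      Real.log (Real.exp 1 * Real.exp L) := by
    rw [hlogA]; linarith
  have hmain := hNW u α β (Real.exp 1 * Real.exp L) (Real.exp 1 * Real.exp L) (Real.exp 1) hu0 hα0 hβ0
    hα hβ (by positivity) (by positivity) le_rfl hA hB
  rw [← hDdef, Real.log_exp, hlogA, one_pow, div_one] at hmain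
  refine le_trans (Real.exp_le_exp.mpr ?_) hmain
  rw [neg_le_neg_iff]
  -- the three factors
  set T : ℝ := ‖u‖ with hT
  have hT0 : 0 ≤ T := norm_nonneg u
  have hlogD : Real.log D ≤ 1 + L := by
    rcases Nat.eq_zero_or_pos D with h | h
    · rw [h]; simp; linarith
    · have := Real.log_le_sub_one_of_pos (by exact_mod_cast h : (0 : ℝ) < D); linarith
  have hlogD0 : 0 ≤ Real.log D := Real.log_natCast_nonneg D
  have hlogΛ : Real.log (1 + L) ≤ 1 + L := by
    have := Real.log_le_sub_one_of_pos (by linarith : (0 : ℝ) < 1 + L); linarith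
  have hlogΛ0 : 0 ≤ Real.log (1 + L) := Real.log_nonneg (by linarith)
  have hlogD2 : Real.log ((D : ℝ) + 2) ≤ 1 + L := by
    have := Real.log_le_sub_one_of_pos (by linarith : (0 : ℝ) < D + 2); linarith
  have hlogD20 : 0 ≤ Real.log ((D : ℝ) + 2) := Real.log_nonneg (by linarith)
  have hmax1 : 1 ≤ max 1 T := le_max_left _ _
  have hlogE : Real.log (Real.exp 1 * max 1 T) ≤ 1 + T := by
    rw [Real.log_mul (Real.exp_pos 1).ne' (by linarith), Real.log_exp]
    have := Real.log_le_sub_one_of_pos (by linarith : (0 : ℝ) < max 1 T)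
    have hmaxT : max 1 T ≤ 1 + T := max_le (by linarith) (by linarith)
    linarith
  have hlogE0 : 0 ≤ Real.log (Real.exp 1 * max 1 T) := Real.log_nonneg
    (one_le_mul_of_one_le_of_one_le (by have := Real.add_one_le_exp (1 : ℝ); linarith) hmax1)
  have hTΛ : 2 * T ≤ T * (1 + L) := by nlinarith
  have hΛsq : 1 + L ≤ (1 + L) ^ 2 := by nlinarith
  have hDΛ2 : (D : ℝ) * (1 + L) ≤ (1 + L) ^ 2 := by nlinarith
  have f1 : (1 + L) + Real.log (1 + L) + 4 * Real.log D + 2 * Real.log (Real.exp 1 * max 1 T) + 10 ≤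
      (12 + T) * (1 + L) := by nlinarith
  have f1pos : 0 ≤ (1 + L) + Real.log (1 + L) + 4 * Real.log D +
      2 * Real.log (Real.exp 1 * max 1 T) + 10 := by positivity
  have two_e_lt_six : 2 * Real.exp 1 < 6 := by
    have := Real.exp_one_lt_d9; linarith
  have f2 : (D : ℝ) * (1 + L) + 2 * Real.exp 1 * T + 6 * 1 ≤ (4 + 3 * T) * (1 + L) ^ 2 := by
    have b : 2 * Real.exp 1 * T ≤ 6 * T := mul_le_mul_of_nonneg_right two_e_lt_six.le hT0
    nlinarith
  have f2pos : 0 ≤ (D : ℝ) * (1 + L) + 2 * Real.exp 1 * T + 6 * 1 := by positivity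
  have f3 : 33 / 10 * (D : ℝ) * Real.log ((D : ℝ) + 2) + 1 ≤ 43 / 10 * (1 + L) ^ 2 := by
    have hm : (D : ℝ) * Real.log ((D : ℝ) + 2) ≤ (1 + L) * (1 + L) := mul_le_mul hDΛ hlogD2 hlogD20 hΛ0
    nlinarith
  have f3pos : 0 ≤ 33 / 10 * (D : ℝ) * Real.log ((D : ℝ) + 2) + 1 := by positivity
  have g1 : 0 ≤ (12 + T) * (1 + L) := mul_nonneg (by linarith) hΛ0
  have g2 : 0 ≤ (4 + 3 * T) * (1 + L) ^ 2 := mul_nonneg (by linarith) (pow_nonneg hΛ0 2)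
  have hprod : c * (D : ℝ) * ((1 + L) + Real.log (1 + L) + 4 * Real.log D +
        2 * Real.log (Real.exp 1 * max 1 T) + 10) *
        ((D : ℝ) * (1 + L) + 2 * Real.exp 1 * T + 6 * 1) *
        (33 / 10 * (D : ℝ) * Real.log ((D : ℝ) + 2) + 1) ≤
      c * (1 + L) * ((12 + T) * (1 + L)) * ((4 + 3 * T) * (1 + L) ^ 2) * (43 / 10 * (1 + L) ^ 2) := by
    have h1 : c * (D : ℝ) ≤ c * (1 + L) := mul_le_mul_of_nonneg_left hDΛ hc
    have h2 := mul_le_mul h1 f1 f1pos (mul_nonneg hc hΛ0)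
    have h3 := mul_le_mul h2 f2 f2pos (mul_nonneg (mul_nonneg hc hΛ0) g1)
    exact mul_le_mul h3 f3 f3pos (mul_nonneg (mul_nonneg (mul_nonneg hc hΛ0) g1) g2)
  have e : c * (1 + L) * ((12 + T) * (1 + L)) * ((4 + 3 * T) * (1 + L) ^ 2) * (43 / 10 * (1 + L) ^ 2) =
      (43 / 10 * c * (12 + T) * (4 + 3 * T)) * (1 + L) ^ 6 := by ring
  linarith [hprod, e]

/-- **P6′. At `c = 400`, HYPOTHESIS-FREE** — the derived constant moves `908(12+T)(4+3T) ↦ 1720(12+T)(4+3T)`. -/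
theorem expPair_lower_bound_400 {u : ℂ} (hu0 : u ≠ 0)
    {α β : ℂ} (hα0 : α ≠ 0) (hβ0 : β ≠ 0) (hα : IsAlgebraic ℚ α) (hβ : IsAlgebraic ℚ β) {L : ℝ}
    (hL1 : 1 ≤ L) (hD : (Module.finrank ℚ ↥(IntermediateField.adjoin ℚ ({α, β} : Set ℂ)) : ℝ) ≤ L)
    (hhα : weilHeight₁ (IntermediateField.adjoin ℚ ({α, β} : Set ℂ)) (fun _ : Unit => α) ≤ L)
    (hhβ : weilHeight₁ (IntermediateField.adjoin ℚ ({α, β} : Set ℂ)) (fun _ : Unit => β) ≤ L) :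
    Real.exp (-(1720 * (12 + ‖u‖) * (4 + 3 * ‖u‖) * (1 + L) ^ 6)) ≤ ‖Complex.exp u - α‖ + ‖u - β‖ := by
  have h := expPair_lower_bound_of_mainR (by norm_num) nw1996MainR_400 hu0 hα0 hβ0 hα hβ hL1 hD hhα hhβ
  have h1720 : (43 : ℝ) / 10 * 400 = 1720 := by norm_num
  rw [h1720] at h
  exact h

end ConsumerTemplate

end Summit.Schanuel.Schanuel.Theorems.RootDecomp1KNW96Core

end
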